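import Mathlib.RingTheory.DedekindDomain.Dvr
import Mathlib.RingTheory.DiscreteValuationRing.Basic
import Mathlib.RingTheory.Localization.Away.Basic
import Mathlib.RingTheory.Localization.AtPrime.Basic
import HarnessLib

/-!
# The generic point as the intersection of the punctured neighbourhoods `D(f) ∩ D(u)` of `𝔭`

Topic: `Literature/RingTheory/DedekindDomain` (companion of `PrimesContaining`). Let `R` be a
Dedekind domain with fraction field `K`, `𝔭` a maximal ideal and `0 ≠ f ∈ 𝔭`. Since `R` has
dimension `≤ 1`, the only prime ideal `𝔮 ⊆ 𝔭` not containing `f` is `(0)`; equivalently the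
localization of `R[1/f]` at (the image of) `R ∖ 𝔭` is the fraction field `K`
(`isLocalization_map_primeCompl_of_away`). In scheme language: `Spec K = lim_{u ∉ 𝔭} D(fu)` is the
limit of the basic open subsets `D(f) ∩ D(u)` of `Spec R` over the open neighbourhoods `D(u)` of
`𝔭` — the index system along which morphisms defined on the generic fibre are spread out to a
punctured neighbourhood of `𝔭` in the local-to-global construction of Néron models
(`Literature.NumberTheory.EllipticCurves.NeronModel*`, with
`Literature.AlgebraicGeometry.Limits.LocalizationDiagram`). The elementwise content is
`exists_dvd_mul_pow_of_mem`: every nonzero `r ∈ R` divides `u * f ^ n` for some `u ∉ 𝔭` — proved in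
the discrete valuation ring `R_𝔭` (Mathlib
`IsLocalization.AtPrime.isDiscreteValuationRing_of_dedekind_domain`), where `r` divides a power of
the non-unit `f ≠ 0`, and then clearing denominators; the localization statement follows from
Mathlib's `IsLocalization.iff_of_le_of_exists_dvd`.

Mathlib searched (pin): `IsLocalization.iff_of_le_of_exists_dvd`, `IsLocalization.of_le`,
`IsDiscreteValuationRing.eq_unit_mul_pow_irreducible`, `IsLocalization.AtPrime.isUnit_to_map_iff`
(used); no statement identifying `Frac R` as a localization of `R[1/f]` at a prime complement.

## References

* Standard (dimension one: Atiyah–Macdonald, *Introduction to Commutative Algebra*, Ch. 9;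
  the Stacks project, Tag 00PD ff. on Dedekind domains). [folklore]
-/

namespace Literature.RingTheory.DedekindDomain

variable {R : Type*} [CommRing R] [IsDedekindDomain R]

/-- Let `R` be a Dedekind domain, `𝔭` a maximal ideal and `0 ≠ f ∈ 𝔭`. Every nonzero `r ∈ R`
divides `u * f ^ n` for some `u ∉ 𝔭` and `n` (in the discrete valuation ring `R_𝔭`, `r` divides
a power of the non-unit `f ≠ 0`; clear denominators). Equivalently: the only prime ideal of
`R[1/f]` disjoint from the image of `R ∖ 𝔭` is `(0)`. [folklore] -/
theorem exists_dvd_mul_pow_of_mem (p : Ideal R) [p.IsMaximal] {f : R} (hf : f ≠ 0) (hfp : f ∈ p)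
    {r : R} (hr : r ≠ 0) : ∃ (u : R) (n : ℕ), u ∉ p ∧ r ∣ u * f ^ n := by
  classical
  have hp0 : p ≠ ⊥ := by
    rintro rfl
    exact hf ((Submodule.mem_bot R).mp hfp)
  let D := Localization.AtPrime p
  haveI : IsDiscreteValuationRing D :=
    IsLocalization.AtPrime.isDiscreteValuationRing_of_dedekind_domain R hp0 D
  have hinj : Function.Injective (algebraMap R D) :=
    IsLocalization.injective D p.primeCompl_le_nonZeroDivisors
  obtain ⟨ϖ, hϖ⟩ := IsDiscreteValuationRing.exists_irreducible D
  have hrD : algebraMap R D r ≠ 0 := (map_ne_zero_iff _ hinj).mpr hr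
  have hfD : algebraMap R D f ≠ 0 := (map_ne_zero_iff _ hinj).mpr hf
  obtain ⟨a, v, hv⟩ := IsDiscreteValuationRing.eq_unit_mul_pow_irreducible hrD hϖ
  obtain ⟨m, w, hw⟩ := IsDiscreteValuationRing.eq_unit_mul_pow_irreducible hfD hϖ
  have hm : m ≠ 0 := by
    rintro rfl
    have hunit : IsUnit (algebraMap R D f) := by
      rw [hw, pow_zero, mul_one]
      exact Units.isUnit w
    exact (IsLocalization.AtPrime.isUnit_to_map_iff D p f).mp hunit hfp
  -- `r ∣ f ^ a` in `D`
  have hdvd : algebraMap R D r ∣ algebraMap R D f ^ a := by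
    rw [hv, hw, mul_pow, ← pow_mul, Units.mul_left_dvd]
    exact dvd_mul_of_dvd_right (pow_dvd_pow ϖ (Nat.le_mul_of_pos_left a (Nat.pos_of_ne_zero hm))) _
  obtain ⟨y', hy'⟩ := hdvd
  -- clear denominators: `y' = y / t`
  obtain ⟨⟨y, t⟩, hyt⟩ := IsLocalization.surj p.primeCompl y'
  -- `f ^ a * t = r * y` in `D`, hence `c * (f ^ a * t) = c * (r * y)` in `R` for some `c ∉ 𝔭`
  have heq : algebraMap R D (f ^ a * t) = algebraMap R D (r * y) := by
    rw [map_mul, map_mul, map_pow, hy', mul_assoc, hyt]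
  obtain ⟨c, hc⟩ := IsLocalization.exists_of_eq (M := p.primeCompl) heq
  refine ⟨c * t, a, ?_, ⟨c * y, ?_⟩⟩
  · exact p.primeCompl.mul_mem c.2 t.2
  · calc (c : R) * t * f ^ a = c * (f ^ a * t) := by ring
      _ = c * (r * y) := hc
      _ = r * (c * y) := by ring

/-- **`K = R[1/f]_{(R ∖ 𝔭)}`.** Let `R` be a Dedekind domain with fraction field `K`, `𝔭` a maximal
ideal, `0 ≠ f ∈ 𝔭`, and `R_f` a model of `R[1/f]` mapping compatibly to `K`. Then `K` is the
localization of `R_f` at the image of `R ∖ 𝔭`: i.e. `Spec K` is the intersection of the open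
subsets `D(f) ∩ D(u)`, `u ∉ 𝔭`, of `Spec R` (the only prime `𝔮 ⊆ 𝔭` with `f ∉ 𝔮` is `(0)`). This
presents the generic point as the limit of the punctured neighbourhoods `D(fu)` of `𝔭` used in
the local-to-global construction of Néron models. [folklore] -/
theorem isLocalization_map_primeCompl_of_away (p : Ideal R) [p.IsMaximal] {f : R} (hf : f ≠ 0)
    (hfp : f ∈ p) (Rf : Type*) [CommRing Rf] [Algebra R Rf] [IsLocalization.Away f Rf]
    (K : Type*) [CommRing K] [Algebra R K] [IsFractionRing R K] [Algebra Rf K]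
    [IsScalarTower R Rf K] :
    IsLocalization (p.primeCompl.map (algebraMap R Rf)) K := by
  have hle : Submonoid.powers f ≤ nonZeroDivisors R := powers_le_nonZeroDivisors_of_noZeroDivisors hf
  haveI : IsDomain Rf := IsLocalization.isDomain_of_le_nonZeroDivisors (M := Submonoid.powers f) Rf hle
  haveI : IsFractionRing Rf K :=
    IsFractionRing.isFractionRing_of_isDomain_of_isLocalization (Submonoid.powers f) Rf K
  have hinj : Function.Injective (algebraMap R Rf) := IsLocalization.injective Rf hle
  refine (IsLocalization.iff_of_le_of_exists_dvd (p.primeCompl.map (algebraMap R Rf))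
    (nonZeroDivisors Rf) ?_ ?_).mpr inferInstance
  · rintro _ ⟨u, hu, rfl⟩
    refine mem_nonZeroDivisors_of_ne_zero ((map_ne_zero_iff _ hinj).mpr ?_)
    rintro rfl
    exact hu p.zero_mem
  · intro x hx
    have hx0 : x ≠ 0 := nonZeroDivisors.ne_zero hx
    obtain ⟨⟨r, k⟩, hrk⟩ := IsLocalization.surj (Submonoid.powers f) x
    -- `x * f^k = r`
    have hr : r ≠ 0 := by
      rintro rfl
      rw [map_zero, mul_eq_zero] at hrk
      rcases hrk with h | h
      · exact hx0 h
      · exact (IsLocalization.map_units Rf k).ne_zero h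
    obtain ⟨u, n, hu, z, hz⟩ := exists_dvd_mul_pow_of_mem p hf hfp hr
    refine ⟨algebraMap R Rf u, ⟨u, hu, rfl⟩, ?_⟩
    -- `u * f^n = r * z`, so `u = x * (f^k * z * (f^n)⁻¹)` in `R_f`
    have hfn : IsUnit (algebraMap R Rf (f ^ n)) := by
      rw [map_pow]; exact (IsLocalization.Away.algebraMap_isUnit f).pow n
    refine ⟨algebraMap R Rf k * algebraMap R Rf z * ↑hfn.unit⁻¹, ?_⟩
    have key : algebraMap R Rf u * algebraMap R Rf (f ^ n) =
        x * (algebraMap R Rf k * algebraMap R Rf z) := by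
      rw [← map_mul, hz, map_mul, ← hrk, mul_assoc]
    calc algebraMap R Rf u
        = algebraMap R Rf u * algebraMap R Rf (f ^ n) * ↑hfn.unit⁻¹ := by
          rw [mul_assoc, IsUnit.mul_val_inv, mul_one]
      _ = x * (algebraMap R Rf k * algebraMap R Rf z * ↑hfn.unit⁻¹) := by
          rw [key]; ring

end Literature.RingTheory.DedekindDomain
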